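import Summits.CriticalPhenomena.PercolationContinuityZ3.Theorems.PercNearOneGluingNoHeavyLowerTailAntitheticTwinTop
import HarnessLib


/-!
# `NoHeavyLowerTail` (stmt-CriticalPhenomena-4575) — antithetic cluster pairs: **THE TOP EVENT FOR AN ARBITRARY PAIR (s, P): the red–red
# and cross parts over the COMMON NEIGHBOURS are nonnegative; CONJECTURE T reduces to the rest** (prim-hp-2 gen 73, HOME/THEOREM-TW.md §3bis)

Support file (`--supports stmt-CriticalPhenomena-4575`, hull-port prover `prim-hp-2`, gen 73).  No definitions, no named facts, no sorries;
standard axioms.  Notation of …AntitheticTwinTop.  Here `s, P` are ARBITRARY vertices; a COMMON NEIGHBOUR is a `v ∉ {s, P}` with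
`sv, Pv ∈ E`; its TYPE on a colouring is (colour of `sv`, colour of `Pv`).  On the top event `{P ∈ X T, P ∉ Y T}` no common neighbour is
blue–blue and every common neighbour lies in `X T`.  The boxes below fix ONLY the pairs `sv`, `Pv` of common neighbours (and, for the cross
part, the pairs between them); all private pairs of `s` and of `P` stay FREE — a blue antipode-step along a free pair is a red step in the
partner.  This generalises …AntitheticTwinTop (twins) and …AntitheticDomTopBoxes (`N(s) ⊆ N(P)`).
* `Antithetic.CommonNbr.top_rr_sum_nonneg` — on EVERY rooted graph and every `P`: `Σ_{top, some common neighbour red–red} K₁K₂ ≥ 0`.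
* `Antithetic.CommonNbr.top_cross_sum_nonneg` — `Σ_{top, no common red–red, some red E-pair jk between a blue-s and a red-s common neighbour} K₁K₂ ≥ 0`.
* `Antithetic.CommonNbr.top_sum_nonneg_of_rest_nested`, `…vertex_sum_nonneg_of_rest_nested` — hence TOP(E; P) ≥ 0 (K-form) and the
  |R| = 1 vertex antithetic inequality at `P` as soon as the tops are nested on the REST of the top event (no common red–red neighbour, no red
  cross pair): every failure of CONJECTURE T (HOME/MEMO-gen69) lives on that rest — e.g. the pendant probe and the `E_k` probe have no usable
  common neighbour there.
[cite: VandenbergHaggstromKahn2005, §1 p. 6 ("Harris' inequality"), §1 p. 3 (open cluster `C_s`)]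
-/

noncomputable section

namespace Summit.CriticalPhenomena.PercolationContinuityZ3.Theorems

open Literature.Probability.Percolation
open scoped Classical

namespace Antithetic

namespace CommonNbr

variable {V : Type*}

section Clusters

variable {E : Set (Sym2 V)} {s P : V}

/-- A red–red common neighbour puts `P` into the red cluster. [this work] -/
theorem mem_red_of_rr {T : Set (Sym2 V)} {v : V} (hvs : v ≠ s) (hvP : v ≠ P) (hvE : s(s, v) ∈ E) (hvPE : s(P, v) ∈ E)
    (hsv : s(s, v) ∈ T) (hPv : s(P, v) ∈ T) : P ∈ openCluster (T ∩ E) s := by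
  have hv : v ∈ openCluster (T ∩ E) s := Twin.mem_red_of_pair (mem_openCluster_self _ s) hsv hvE hvs.symm
  exact Twin.mem_red_of_pair hv (by rw [Sym2.eq_swap]; exact hPv) (by rw [Sym2.eq_swap]; exact hvPE) hvP

/-- On the top event no common neighbour is blue–blue. [this work] -/
theorem noBB_of_top {T : Set (Sym2 V)} (hPY : P ∉ openCluster (Tᶜ ∩ E) s) {v : V} (hvs : v ≠ s) (hvP : v ≠ P) (hvE : s(s, v) ∈ E)
    (hvPE : s(P, v) ∈ E) : s(s, v) ∈ T ∨ s(P, v) ∈ T := by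
  by_contra h
  have h1 : s(s, v) ∉ T := fun h' => h (Or.inl h')
  have h2 : s(P, v) ∉ T := fun h' => h (Or.inr h')
  have hv : v ∈ openCluster (Tᶜ ∩ E) s := Twin.mem_blue_of_pair (mem_openCluster_self _ s) h1 hvE hvs.symm
  exact hPY (Twin.mem_blue_of_pair hv (by rw [Sym2.eq_swap]; exact h2) (by rw [Sym2.eq_swap]; exact hvPE) hvP)

/-- On the top event an `E`-pair between a blue-`s` common neighbour `j` and a blue-`P` common neighbour `k` is red. [this work] -/
theorem cross_red_of_top {T : Set (Sym2 V)} (hPY : P ∉ openCluster (Tᶜ ∩ E) s) {j k : V} (hjs : j ≠ s) (hkP : k ≠ P)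
    (hjE : s(s, j) ∈ E) (hkPE : s(P, k) ∈ E) (hsj : s(s, j) ∉ T) (hPk : s(P, k) ∉ T) (hjkE : s(j, k) ∈ E) (hjk : j ≠ k) :
    s(j, k) ∈ T := by
  by_contra h
  have hj : j ∈ openCluster (Tᶜ ∩ E) s := Twin.mem_blue_of_pair (mem_openCluster_self _ s) hsj hjE hjs.symm
  have hk : k ∈ openCluster (Tᶜ ∩ E) s := Twin.mem_blue_of_pair hj h hjkE hjk
  exact hPY (Twin.mem_blue_of_pair hk (by rw [Sym2.eq_swap]; exact hPk) (by rw [Sym2.eq_swap]; exact hkPE) hkP)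

/-- **Red domination of the common-neighbour boxes.**  `T'` is opposite to `T` off the pairs `sv`, `Pv` of the common neighbours `v`
and off a further set `C` of pairs joining two common neighbours (on these pairs NOTHING is required of `T'`); in `T`: `P ∈ X T` and no common
neighbour is blue–blue.  Then `Y T' ⊆ X T` (every pair at a common neighbour leads into `X T`, every other blue pair of `T'` is red in `T`).
[this work] -/
theorem dom_of_agree {T T' : Set (Sym2 V)} (C : Set (Sym2 V))
    (hC : ∀ e ∈ C, ∃ j k, e = s(j, k) ∧ (j ≠ s ∧ j ≠ P ∧ s(s, j) ∈ E ∧ s(P, j) ∈ E) ∧ (k ≠ s ∧ k ≠ P ∧ s(s, k) ∈ E ∧ s(P, k) ∈ E))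
    (hflip : ∀ e : Sym2 V, (¬ ∃ v, v ≠ s ∧ v ≠ P ∧ s(s, v) ∈ E ∧ s(P, v) ∈ E ∧ (e = s(s, v) ∨ e = s(P, v))) → e ∉ C →
      (e ∈ T' ↔ e ∉ T))
    (hPX : P ∈ openCluster (T ∩ E) s)
    (hnoBB : ∀ v, v ≠ s → v ≠ P → s(s, v) ∈ E → s(P, v) ∈ E → s(s, v) ∈ T ∨ s(P, v) ∈ T) :
    openCluster (T'ᶜ ∩ E) s ⊆ openCluster (T ∩ E) s := by
  have hN : ∀ v, v ≠ s → v ≠ P → s(s, v) ∈ E → s(P, v) ∈ E → v ∈ openCluster (T ∩ E) s := by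
    intro v hvs hvP hvE hvPE
    rcases hnoBB v hvs hvP hvE hvPE with h | h
    · exact Twin.mem_red_of_pair (mem_openCluster_self _ s) h hvE hvs.symm
    · exact Twin.mem_red_of_pair hPX h hvPE hvP.symm
  refine TwoStage.Fan.cluster_subset_of_closed (mem_openCluster_self _ s) fun u w hu huw => ?_
  obtain ⟨⟨hT', hE⟩, hne⟩ := (openGraph_adj _ u w).1 huw
  by_cases hws : w = s
  · rw [hws]; exact mem_openCluster_self _ s
  by_cases hwP : w = P
  · rw [hwP]; exact hPX
  by_cases hfix : ∃ v, v ≠ s ∧ v ≠ P ∧ s(s, v) ∈ E ∧ s(P, v) ∈ E ∧ (s(u, w) = s(s, v) ∨ s(u, w) = s(P, v))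
  · obtain ⟨v, hvs, hvP, hvE, hvPE, huv⟩ := hfix
    rcases huv with huv | huv
    · rcases Sym2.eq_iff.1 huv with ⟨-, hw⟩ | ⟨-, hw⟩
      · rw [hw]; exact hN v hvs hvP hvE hvPE
      · exact absurd hw hws
    · rcases Sym2.eq_iff.1 huv with ⟨-, hw⟩ | ⟨-, hw⟩
      · rw [hw]; exact hN v hvs hvP hvE hvPE
      · exact absurd hw hwP
  by_cases hCe : s(u, w) ∈ C
  · obtain ⟨j, k, hejk, hj, hk⟩ := hC _ hCe
    rcases Sym2.eq_iff.1 hejk with ⟨-, hw⟩ | ⟨-, hw⟩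
    · rw [hw]; exact hN k hk.1 hk.2.1 hk.2.2.1 hk.2.2.2
    · rw [hw]; exact hN j hj.1 hj.2.1 hj.2.2.1 hj.2.2.2
  · have hTr : s(u, w) ∈ T := by
      by_contra h
      exact hT' ((hflip _ hfix hCe).2 h)
    exact Twin.mem_red_of_pair hu hTr hE hne

end Clusters

variable [Fintype V]

/-- **The red–red part of the top event, any pair `(s, P)` (`K`-form).**  `Σ_{T : P ∈ X T, P ∉ Y T, some common neighbour red–red} K₁K₂ ≥ 0`.
[this work] -/
theorem top_rr_sum_nonneg (E : Set (Sym2 V)) (s P : V)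
    {K₁ K₂ : Set V → Set V → ℝ}
    (hK₁ : ∀ ⦃A A' B B' : Set V⦄, A ⊆ A' → B' ⊆ B → K₁ A B ≤ K₁ A' B') (hso₁ : ∀ A B, 0 ≤ K₁ A B + K₁ B A)
    (hK₂ : ∀ ⦃A A' B B' : Set V⦄, A ⊆ A' → B' ⊆ B → K₂ A B ≤ K₂ A' B') (hso₂ : ∀ A B, 0 ≤ K₂ A B + K₂ B A) :
    0 ≤ ∑ T ∈ Finset.univ.filter (fun T : Set (Sym2 V) => P ∈ openCluster (T ∩ E) s ∧ P ∉ openCluster (Tᶜ ∩ E) s ∧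
        ∃ v, v ≠ s ∧ v ≠ P ∧ s(s, v) ∈ E ∧ s(P, v) ∈ E ∧ s(s, v) ∈ T ∧ s(P, v) ∈ T),
      K₁ (openCluster (T ∩ E) s) (openCluster (Tᶜ ∩ E) s) * K₂ (openCluster (T ∩ E) s) (openCluster (Tᶜ ∩ E) s) := by
  let nbr : V → Prop := fun v => v ≠ s ∧ v ≠ P ∧ s(s, v) ∈ E ∧ s(P, v) ∈ E
  let A : Set (Sym2 V) := {e | ∃ v, nbr v ∧ (e = s(s, v) ∨ e = s(P, v))}
  let good : Set (Sym2 V) → Prop := fun N =>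
    (∃ v, nbr v ∧ s(s, v) ∈ N ∧ s(P, v) ∈ N) ∧ (∀ v, nbr v → s(s, v) ∈ N ∨ s(P, v) ∈ N)
  have hsA : ∀ v, nbr v → s(s, v) ∈ A := fun v hv => ⟨v, hv, Or.inl rfl⟩
  have hPA : ∀ v, nbr v → s(P, v) ∈ A := fun v hv => ⟨v, hv, Or.inr rfl⟩
  have hgood_iff : ∀ N M : Set (Sym2 V), (∀ e ∈ A, (e ∈ M ↔ e ∈ N)) → (good N ↔ good M) := by
    intro N M h
    constructor
    · rintro ⟨⟨v, hv, h1, h2⟩, hno⟩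
      exact ⟨⟨v, hv, (h _ (hsA v hv)).2 h1, (h _ (hPA v hv)).2 h2⟩, fun v hv' => (hno v hv').imp (h _ (hsA v hv')).2 (h _ (hPA v hv')).2⟩
    · rintro ⟨⟨v, hv, h1, h2⟩, hno⟩
      exact ⟨⟨v, hv, (h _ (hsA v hv)).1 h1, (h _ (hPA v hv)).1 h2⟩, fun v hv' => (hno v hv').imp (h _ (hsA v hv')).1 (h _ (hPA v hv')).1⟩
  let C := {N : Set (Sym2 V) // N ⊆ A ∧ good N}
  let D : Finset (Set (Sym2 V)) := Finset.univ.filter fun T => good T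
  have hfreeze := Box.freeze_boxes_sum_nonneg E s D (fun _ : C => A) (fun c : C => c.1)
    (fun T hT => ?_) (fun c T hT => ?_) (fun c c' T hc hc' => ?_) (fun c T T' hT hT' hflip => ?_) {P} hK₁ hso₁ hK₂ hso₂
  · have hev : D.filter (fun T => ∀ Q ∈ ({P} : Set V), Q ∉ openCluster (Tᶜ ∩ E) s) =
        Finset.univ.filter (fun T : Set (Sym2 V) => P ∈ openCluster (T ∩ E) s ∧ P ∉ openCluster (Tᶜ ∩ E) s ∧
          ∃ v, v ≠ s ∧ v ≠ P ∧ s(s, v) ∈ E ∧ s(P, v) ∈ E ∧ s(s, v) ∈ T ∧ s(P, v) ∈ T) := by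
      ext T
      simp only [D, Finset.mem_filter, Finset.mem_univ, true_and, Set.mem_singleton_iff, forall_eq]
      constructor
      · rintro ⟨⟨⟨v, hv, h1, h2⟩, -⟩, hPY⟩
        exact ⟨mem_red_of_rr hv.1 hv.2.1 hv.2.2.1 hv.2.2.2 h1 h2, hPY, v, hv.1, hv.2.1, hv.2.2.1, hv.2.2.2, h1, h2⟩
      · rintro ⟨-, hPY, v, hvs, hvP, hvE, hvPE, h1, h2⟩
        exact ⟨⟨⟨v, ⟨hvs, hvP, hvE, hvPE⟩, h1, h2⟩, fun w hw => noBB_of_top hPY hw.1 hw.2.1 hw.2.2.1 hw.2.2.2⟩, hPY⟩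
    rw [← hev]
    exact hfreeze
  · have hgT : good T := (Finset.mem_filter.1 hT).2
    refine ⟨⟨T ∩ A, Set.inter_subset_right, (hgood_iff T (T ∩ A) fun e he => ⟨fun h => h.1, fun h => ⟨h, he⟩⟩).1 hgT⟩,
      fun e he => ⟨fun h => ⟨h, he⟩, fun h => h.1⟩⟩
  · exact Finset.mem_filter.2 ⟨Finset.mem_univ _, (hgood_iff c.1 T hT).1 c.2.2⟩
  · apply Subtype.ext
    ext e
    constructor
    · intro he
      exact (hc' e (c.2.1 he)).1 ((hc e (c.2.1 he)).2 he)
    · intro he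
      exact (hc e (c'.2.1 he)).1 ((hc' e (c'.2.1 he)).2 he)
  · have hgT : good T := (hgood_iff c.1 T hT).1 c.2.2
    obtain ⟨⟨v, hv, h1, h2⟩, hnoBB⟩ := hgT
    refine dom_of_agree ∅ (fun e he => absurd he (Set.notMem_empty e))
      (fun e hne _ => hflip e ?_) (mem_red_of_rr hv.1 hv.2.1 hv.2.2.1 hv.2.2.2 h1 h2) (fun w hws hwP hwE hwPE => hnoBB w ⟨hws, hwP, hwE, hwPE⟩)
    · rintro ⟨w, hw, he⟩
      exact hne ⟨w, hw.1, hw.2.1, hw.2.2.1, hw.2.2.2, he⟩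

/-- **The cross part of the top event, any pair `(s, P)` (`K`-form).**
`Σ_{T : top, no common neighbour red–red, some red E-pair jk with j, k common neighbours, sj blue, sk red} K₁K₂ ≥ 0`. [this work] -/
theorem top_cross_sum_nonneg (E : Set (Sym2 V)) (s P : V)
    {K₁ K₂ : Set V → Set V → ℝ}
    (hK₁ : ∀ ⦃A A' B B' : Set V⦄, A ⊆ A' → B' ⊆ B → K₁ A B ≤ K₁ A' B') (hso₁ : ∀ A B, 0 ≤ K₁ A B + K₁ B A)
    (hK₂ : ∀ ⦃A A' B B' : Set V⦄, A ⊆ A' → B' ⊆ B → K₂ A B ≤ K₂ A' B') (hso₂ : ∀ A B, 0 ≤ K₂ A B + K₂ B A) :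
    0 ≤ ∑ T ∈ Finset.univ.filter (fun T : Set (Sym2 V) => P ∈ openCluster (T ∩ E) s ∧ P ∉ openCluster (Tᶜ ∩ E) s ∧
        (∀ v, v ≠ s → v ≠ P → s(s, v) ∈ E → s(P, v) ∈ E → ¬ (s(s, v) ∈ T ∧ s(P, v) ∈ T)) ∧
        ∃ j k, (j ≠ s ∧ j ≠ P ∧ s(s, j) ∈ E ∧ s(P, j) ∈ E) ∧ (k ≠ s ∧ k ≠ P ∧ s(s, k) ∈ E ∧ s(P, k) ∈ E) ∧
          s(s, j) ∉ T ∧ s(s, k) ∈ T ∧ s(j, k) ∈ E ∧ s(j, k) ∈ T),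
      K₁ (openCluster (T ∩ E) s) (openCluster (Tᶜ ∩ E) s) * K₂ (openCluster (T ∩ E) s) (openCluster (Tᶜ ∩ E) s) := by
  let nbr : V → Prop := fun v => v ≠ s ∧ v ≠ P ∧ s(s, v) ∈ E ∧ s(P, v) ∈ E
  let A : Set (Sym2 V) := {e | ∃ v, nbr v ∧ (e = s(s, v) ∨ e = s(P, v))}
  let cross : Set (Sym2 V) → Set (Sym2 V) := fun N =>
    {e | ∃ j k, e = s(j, k) ∧ nbr j ∧ nbr k ∧ s(s, j) ∉ N ∧ s(s, k) ∈ N}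
  let Fix : Set (Sym2 V) → Set (Sym2 V) := fun N => A ∪ cross N
  let good : Set (Sym2 V) → Prop := fun N =>
    (∀ v, nbr v → (s(s, v) ∈ N ↔ s(P, v) ∉ N)) ∧
    (∃ j k, nbr j ∧ nbr k ∧ s(s, j) ∉ N ∧ s(s, k) ∈ N ∧ s(j, k) ∈ E ∧ s(j, k) ∈ N)
  have hsA : ∀ N v, nbr v → s(s, v) ∈ Fix N := fun N v hv => Or.inl ⟨v, hv, Or.inl rfl⟩
  have hPA : ∀ N v, nbr v → s(P, v) ∈ Fix N := fun N v hv => Or.inl ⟨v, hv, Or.inr rfl⟩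
  have hcross_eq : ∀ N M : Set (Sym2 V), (∀ v, nbr v → (s(s, v) ∈ M ↔ s(s, v) ∈ N)) → cross N = cross M := by
    intro N M h
    ext e
    simp only [cross, Set.mem_setOf_eq]
    constructor
    · rintro ⟨j, k, he, hj, hk, h1, h2⟩
      exact ⟨j, k, he, hj, hk, fun h' => h1 ((h j hj).1 h'), (h k hk).2 h2⟩
    · rintro ⟨j, k, he, hj, hk, h1, h2⟩
      exact ⟨j, k, he, hj, hk, fun h' => h1 ((h j hj).2 h'), (h k hk).1 h2⟩
  have hFix_eq : ∀ N M : Set (Sym2 V), (∀ v, nbr v → (s(s, v) ∈ M ↔ s(s, v) ∈ N)) → Fix N = Fix M := by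
    intro N M h
    show A ∪ cross N = A ∪ cross M
    rw [hcross_eq N M h]
  have hgood_of : ∀ N M : Set (Sym2 V), (∀ e ∈ Fix N, (e ∈ M ↔ e ∈ N)) → good N → good M := by
    rintro N M h ⟨htype, j, k, hj, hk, h1, h2, h3, h4⟩
    refine ⟨fun v hv => ?_, j, k, hj, hk, fun h' => h1 ((h _ (hsA N j hj)).1 h'), (h _ (hsA N k hk)).2 h2, h3, ?_⟩
    · rw [h _ (hsA N v hv), h _ (hPA N v hv)]
      exact htype v hv
    · have hjk : s(j, k) ∈ Fix N := Or.inr ⟨j, k, rfl, hj, hk, h1, h2⟩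
      exact (h _ hjk).2 h4
  let C := {N : Set (Sym2 V) // N ⊆ Fix N ∧ good N}
  let D : Finset (Set (Sym2 V)) := Finset.univ.filter fun T => good T
  have hfreeze := Box.freeze_boxes_sum_nonneg E s D (fun c : C => Fix c.1) (fun c : C => c.1)
    (fun T hT => ?_) (fun c T hT => ?_) (fun c c' T hc hc' => ?_) (fun c T T' hT hT' hflip => ?_) {P} hK₁ hso₁ hK₂ hso₂
  · have hev : D.filter (fun T => ∀ Q ∈ ({P} : Set V), Q ∉ openCluster (Tᶜ ∩ E) s) =
        Finset.univ.filter (fun T : Set (Sym2 V) => P ∈ openCluster (T ∩ E) s ∧ P ∉ openCluster (Tᶜ ∩ E) s ∧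
          (∀ v, v ≠ s → v ≠ P → s(s, v) ∈ E → s(P, v) ∈ E → ¬ (s(s, v) ∈ T ∧ s(P, v) ∈ T)) ∧
          ∃ j k, (j ≠ s ∧ j ≠ P ∧ s(s, j) ∈ E ∧ s(P, j) ∈ E) ∧ (k ≠ s ∧ k ≠ P ∧ s(s, k) ∈ E ∧ s(P, k) ∈ E) ∧
            s(s, j) ∉ T ∧ s(s, k) ∈ T ∧ s(j, k) ∈ E ∧ s(j, k) ∈ T) := by
      ext T
      simp only [D, Finset.mem_filter, Finset.mem_univ, true_and, Set.mem_singleton_iff, forall_eq]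
      constructor
      · rintro ⟨⟨htype, j, k, hj, hk, h1, h2, h3, h4⟩, hPY⟩
        have hjk : j ≠ k := fun h => h1 (h ▸ h2)
        have hkX : k ∈ openCluster (T ∩ E) s := Twin.mem_red_of_pair (mem_openCluster_self _ s) h2 hk.2.2.1 hk.1.symm
        have hjX : j ∈ openCluster (T ∩ E) s :=
          Twin.mem_red_of_pair hkX (by rw [Sym2.eq_swap]; exact h4) (by rw [Sym2.eq_swap]; exact h3) hjk.symm
        have hPj : s(P, j) ∈ T := by
          by_contra h
          exact h1 ((htype j hj).2 h)
        have hPX : P ∈ openCluster (T ∩ E) s :=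
          Twin.mem_red_of_pair hjX (by rw [Sym2.eq_swap]; exact hPj) (by rw [Sym2.eq_swap]; exact hj.2.2.2) hj.2.1
        refine ⟨hPX, hPY, fun v hvs hvP hvE hvPE h => ?_, j, k, hj, hk, h1, h2, h3, h4⟩
        exact ((htype v ⟨hvs, hvP, hvE, hvPE⟩).1 h.1) h.2
      · rintro ⟨-, hPY, hnoRR, j, k, hj, hk, h1, h2, h3, h4⟩
        refine ⟨⟨fun v hv => ⟨fun h h' => hnoRR v hv.1 hv.2.1 hv.2.2.1 hv.2.2.2 ⟨h, h'⟩, fun h => ?_⟩, j, k, hj, hk, h1, h2, h3, h4⟩, hPY⟩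
        rcases noBB_of_top hPY hv.1 hv.2.1 hv.2.2.1 hv.2.2.2 with h' | h'
        · exact h'
        · exact absurd h' h
    rw [← hev]
    exact hfreeze
  · have hgT : good T := (Finset.mem_filter.1 hT).2
    have hFT : Fix (T ∩ Fix T) = Fix T :=
      (hFix_eq T (T ∩ Fix T) fun v hv => ⟨fun h => h.1, fun h => ⟨h, hsA T v hv⟩⟩).symm
    refine ⟨⟨T ∩ Fix T, ?_, ?_⟩, fun e he => ?_⟩
    · rw [hFT]; exact Set.inter_subset_right
    · exact hgood_of T (T ∩ Fix T) (fun e he => ⟨fun h => h.1, fun h => ⟨h, he⟩⟩) hgT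
    · change e ∈ Fix (T ∩ Fix T) at he
      rw [hFT] at he
      exact ⟨fun h => ⟨h, he⟩, fun h => h.1⟩
  · exact Finset.mem_filter.2 ⟨Finset.mem_univ _, hgood_of c.1 T hT c.2.2⟩
  · have hF : ∀ d : C, (∀ e ∈ Fix d.1, (e ∈ T ↔ e ∈ d.1)) → Fix d.1 = Fix T := fun d hd =>
      hFix_eq d.1 T fun v hv => hd _ (hsA d.1 v hv)
    have hval : ∀ d : C, (∀ e ∈ Fix d.1, (e ∈ T ↔ e ∈ d.1)) → d.1 = T ∩ Fix T := by
      intro d hd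
      ext e
      constructor
      · intro he
        have heF : e ∈ Fix d.1 := d.2.1 he
        exact ⟨(hd e heF).2 he, (hF d hd) ▸ heF⟩
      · rintro ⟨heT, heF⟩
        rw [← hF d hd] at heF
        exact (hd e heF).1 heT
    exact Subtype.ext ((hval c hc).trans (hval c' hc').symm)
  · have hgT : good T := hgood_of c.1 T hT c.2.2
    obtain ⟨htype, j₀, k₀, hj₀, hk₀, h1, h2, h3, h4⟩ := hgT
    have hFc : Fix c.1 = Fix T := hFix_eq c.1 T fun v hv => hT _ (hsA c.1 v hv)
    have hjk₀ : j₀ ≠ k₀ := fun h => h1 (h ▸ h2)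
    have hk₀X : k₀ ∈ openCluster (T ∩ E) s := Twin.mem_red_of_pair (mem_openCluster_self _ s) h2 hk₀.2.2.1 hk₀.1.symm
    have hj₀X : j₀ ∈ openCluster (T ∩ E) s :=
      Twin.mem_red_of_pair hk₀X (by rw [Sym2.eq_swap]; exact h4) (by rw [Sym2.eq_swap]; exact h3) hjk₀.symm
    have hPj₀ : s(P, j₀) ∈ T := by
      by_contra h
      exact h1 ((htype j₀ hj₀).2 h)
    have hPX : P ∈ openCluster (T ∩ E) s :=
      Twin.mem_red_of_pair hj₀X (by rw [Sym2.eq_swap]; exact hPj₀) (by rw [Sym2.eq_swap]; exact hj₀.2.2.2) hj₀.2.1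
    have hnoBB : ∀ v, v ≠ s → v ≠ P → s(s, v) ∈ E → s(P, v) ∈ E → s(s, v) ∈ T ∨ s(P, v) ∈ T := by
      intro v hvs hvP hvE hvPE
      by_cases h : s(s, v) ∈ T
      · exact Or.inl h
      · exact Or.inr (by by_contra h'; exact h ((htype v ⟨hvs, hvP, hvE, hvPE⟩).2 h'))
    refine dom_of_agree (cross T) (fun e he => ?_) (fun e hne hCe => hflip e ?_) hPX hnoBB
    · obtain ⟨j, k, hejk, hj, hk, -, -⟩ := he
      exact ⟨j, k, hejk, hj, hk⟩
    · intro heF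
      rw [hFc] at heF
      rcases heF with ⟨w, hw, he⟩ | h
      · exact hne ⟨w, hw.1, hw.2.1, hw.2.2.1, hw.2.2.2, he⟩
      · exact hCe h

/-- **CONJECTURE T reduces to the rest of the top event.**  If on every colouring of the top event with no common red–red neighbour and no
red cross pair (equivalently: no `E`-pair between a blue-`s` and a red-`s`-blue-`P` common neighbour) the tops are nested, `Y T ⊆ X T`, then
`0 ≤ Σ_{T : P ∈ X T, P ∉ Y T} K₁(X T, Y T)·K₂(X T, Y T)` for all super-odd twisted-monotone `K₁, K₂`. [this work] -/
theorem top_sum_nonneg_of_rest_nested (E : Set (Sym2 V)) (s P : V)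
    (hrest : ∀ T : Set (Sym2 V), P ∈ openCluster (T ∩ E) s → P ∉ openCluster (Tᶜ ∩ E) s →
      (∀ v, v ≠ s → v ≠ P → s(s, v) ∈ E → s(P, v) ∈ E → ¬ (s(s, v) ∈ T ∧ s(P, v) ∈ T)) →
      (∀ j k, j ≠ s → j ≠ P → s(s, j) ∈ E → s(P, j) ∈ E → k ≠ s → k ≠ P → s(s, k) ∈ E → s(P, k) ∈ E →
        s(s, j) ∉ T → s(s, k) ∈ T → s(j, k) ∈ E → s(j, k) ∉ T) →
      openCluster (Tᶜ ∩ E) s ⊆ openCluster (T ∩ E) s)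
    {K₁ K₂ : Set V → Set V → ℝ}
    (hK₁ : ∀ ⦃A A' B B' : Set V⦄, A ⊆ A' → B' ⊆ B → K₁ A B ≤ K₁ A' B') (hso₁ : ∀ A B, 0 ≤ K₁ A B + K₁ B A)
    (hK₂ : ∀ ⦃A A' B B' : Set V⦄, A ⊆ A' → B' ⊆ B → K₂ A B ≤ K₂ A' B') (hso₂ : ∀ A B, 0 ≤ K₂ A B + K₂ B A) :
    0 ≤ ∑ T ∈ Finset.univ.filter (fun T : Set (Sym2 V) => P ∈ openCluster (T ∩ E) s ∧ P ∉ openCluster (Tᶜ ∩ E) s),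
      K₁ (openCluster (T ∩ E) s) (openCluster (Tᶜ ∩ E) s) * K₂ (openCluster (T ∩ E) s) (openCluster (Tᶜ ∩ E) s) := by
  have hrr := top_rr_sum_nonneg E s P hK₁ hso₁ hK₂ hso₂
  have hcr := top_cross_sum_nonneg E s P hK₁ hso₁ hK₂ hso₂
  have hdisj : Disjoint
      (Finset.univ.filter (fun T : Set (Sym2 V) => P ∈ openCluster (T ∩ E) s ∧ P ∉ openCluster (Tᶜ ∩ E) s ∧
        ∃ v, v ≠ s ∧ v ≠ P ∧ s(s, v) ∈ E ∧ s(P, v) ∈ E ∧ s(s, v) ∈ T ∧ s(P, v) ∈ T))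
      (Finset.univ.filter (fun T : Set (Sym2 V) => P ∈ openCluster (T ∩ E) s ∧ P ∉ openCluster (Tᶜ ∩ E) s ∧
        (∀ v, v ≠ s → v ≠ P → s(s, v) ∈ E → s(P, v) ∈ E → ¬ (s(s, v) ∈ T ∧ s(P, v) ∈ T)) ∧
        ∃ j k, (j ≠ s ∧ j ≠ P ∧ s(s, j) ∈ E ∧ s(P, j) ∈ E) ∧ (k ≠ s ∧ k ≠ P ∧ s(s, k) ∈ E ∧ s(P, k) ∈ E) ∧
          s(s, j) ∉ T ∧ s(s, k) ∈ T ∧ s(j, k) ∈ E ∧ s(j, k) ∈ T)) := by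
    rw [Finset.disjoint_filter]
    rintro T - ⟨-, -, v, hvs, hvP, hvE, hvPE, h1, h2⟩ ⟨-, -, hno, -⟩
    exact hno v hvs hvP hvE hvPE ⟨h1, h2⟩
  have hsum := add_nonneg hrr hcr
  rw [← Finset.sum_union hdisj] at hsum
  refine hsum.trans (Finset.sum_le_sum_of_subset_of_nonneg (fun T hT => ?_) (fun T hT hT' => ?_))
  · rw [Finset.mem_union] at hT
    simp only [Finset.mem_filter, Finset.mem_univ, true_and] at hT ⊢
    rcases hT with h | h
    · exact ⟨h.1, h.2.1⟩
    · exact ⟨h.1, h.2.1⟩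
  · rw [Finset.mem_union, not_or] at hT'
    simp only [Finset.mem_filter, Finset.mem_univ, true_and] at hT hT'
    obtain ⟨hPX, hPY⟩ := hT
    obtain ⟨h1, h2⟩ := hT'
    have hnoRR : ∀ v, v ≠ s → v ≠ P → s(s, v) ∈ E → s(P, v) ∈ E → ¬ (s(s, v) ∈ T ∧ s(P, v) ∈ T) :=
      fun v hvs hvP hvE hvPE h => h1 ⟨hPX, hPY, v, hvs, hvP, hvE, hvPE, h.1, h.2⟩
    have hnoX : ∀ j k, j ≠ s → j ≠ P → s(s, j) ∈ E → s(P, j) ∈ E → k ≠ s → k ≠ P → s(s, k) ∈ E → s(P, k) ∈ E →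
        s(s, j) ∉ T → s(s, k) ∈ T → s(j, k) ∈ E → s(j, k) ∉ T :=
      fun j k hjs hjP hjE hjPE hks hkP hkE hkPE hsj hsk hjkE hjk =>
        h2 ⟨hPX, hPY, hnoRR, j, k, ⟨hjs, hjP, hjE, hjPE⟩, ⟨hks, hkP, hkE, hkPE⟩, hsj, hsk, hjkE, hjk⟩
    have hYX := hrest T hPX hPY hnoRR hnoX
    have ha : 0 ≤ K₁ (openCluster (T ∩ E) s) (openCluster (Tᶜ ∩ E) s) := by
      have h' := hso₁ (openCluster (Tᶜ ∩ E) s) (openCluster (Tᶜ ∩ E) s)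
      have h'' := hK₁ hYX (subset_refl (openCluster (Tᶜ ∩ E) s))
      linarith
    have hb : 0 ≤ K₂ (openCluster (T ∩ E) s) (openCluster (Tᶜ ∩ E) s) := by
      have h' := hso₂ (openCluster (Tᶜ ∩ E) s) (openCluster (Tᶜ ∩ E) s)
      have h'' := hK₂ hYX (subset_refl (openCluster (Tᶜ ∩ E) s))
      linarith
    exact mul_nonneg ha hb

end CommonNbr

end Antithetic

end Summit.CriticalPhenomena.PercolationContinuityZ3.Theorems
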